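import Summits.BirchSwinnertonDyer.BirchSwinnertonDyer.Theorems.EisensteinPrimesFullDescentTateAlgebraThree
import HarnessLib

/-!
# Crux `GoodLatticeBDPValue` (stmt-BirchSwinnertonDyer-19032), line `halves`, AN-3 Stub B road — brick F5:
# the ABSTRACT SPLITTING LEMMA (a hand-made `H¹` in degree one, modulo a stable subgroup)

Width seat bsd-line-x1-p1-w3 (gen 4). HONEST FRAMING (cell `bsd-eis`, run/shared/lean/pub/bsd-eis/):
TOOL THEOREM ONLY (no `def`, no named fact, no `sorry`); pure group theory — nothing about a curve, a
number field, a summit statement, Keller–Yin Thm. 2.2.2 or crux 2 is proved here; 0 stubs / cells /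
labels move.

WHY (road memo `HOME/line-x1-p1-w3-g4/AN3-StubB-elementary-road.md`, evidence #44 on the item, steps
B3 and A2). Twice in the elementary proof of Theorem T′ (`HalvesAnThreeSplit.FullDescentAtThreeOfRed`)
one meets a `G_ℚ`-module `M` (namely `E[3]`, resp. `3⁻¹C/C ≤ E[9]/C`) which is an extension of the
`ω`-line by the trivial line — a fixed vector `P` and a vector `Q` with `σQ ≡ ω(σ)Q + c(σ)P` — and one
wants it to SPLIT (`M ≅ 𝟙 ⊕ ω`). The obstruction is the class of the cocycle `c` in `H¹(G_ℚ, 𝔽₃(ω))`;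
restricted to `K = ker ω = G_{ℚ(ζ₃)}` it is a HOMOMORPHISM `η : K → ℤ/3`, which the local information
kills on every inertia group (Tate primes: brick F1 (T-a)/(T-d); good primes: Néron–Ogg–Shafarevich)
and on the decomposition group at `3` (where a complement — the kernel-of-reduction line — is
stable); the arithmetic input «`ℚ(ζ₃)` has no unramified cyclic cubic extension» (class number one)
then gives `η = 0`, and since `[G : K] = 2` is prime to `3` the cocycle itself is a coboundary
(`a := c(τ)` for any `τ ∉ K`). This file is exactly that argument, ABSTRACTLY: a group `G` acting on
an abelian group `M`, everything read modulo a `G`-stable subgroup `C` (so that the level-9 use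
`M = 3⁻¹C`, `C = ` the `ω`-line of `E[3]`, needs no quotient module), the arithmetic input being the
hypothesis `hGK` on homomorphisms `ker ω → ℤ/3`.

* `exists_stable_complement_mod` — THE LEMMA: under (i) `σP ≡ P`, `σQ ≡ ω(σ)Q + c(σ)P (mod C)` with
  `P, Q` independent of order `3` mod `C`; (ii) a family of subgroups `I j` fixing `Q` mod `C`; (iii) a
  family of subgroups `D k` each stabilising a subgroup `Λ_k` that contains a representative of some
  `Q + aP` and meets `ℤ•P + C` only in `C`; (iv) `hGK`: every hom `ker ω →* ℤ/3` killing the `I j ∩ ker ω`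
  and the `D k ∩ ker ω` is trivial — there is `a : ℤ` with `σ(Q + aP) ≡ ω(σ)(Q + aP) (mod C)` for ALL
  `σ ∈ G`, i.e. `ℤ•(Q + aP) + C` is a `G`-stable complement of `ℤ•P + C` over `C`.

References: [SerreLocalFields1979] J.-P. Serre, *Local Fields*, GTM 67, Ch. VII §§1–2 (cocycles,
restriction to a normal subgroup of index prime to the exponent); [Washington1997] L. C. Washington,
*Introduction to Cyclotomic Fields*, GTM 83, Thm. 11.1 (`h(ℚ(ζ₃)) = 1`, the intended instance of `hGK`).
-/

set_option autoImplicit false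
set_option linter.dupNamespace false

namespace Summit.BirchSwinnertonDyer.BirchSwinnertonDyer.Theorems.FullDescentSplitting

open Summit.BirchSwinnertonDyer.BirchSwinnertonDyer.Theorems.FullDescentTateAlgebra (smul_zsmul_comm)

variable {G M : Type*} [Group G] [AddCommGroup M] [DistribMulAction G M]

/-- A `G`-stable subgroup `C`: congruent elements have congruent images. [folklore] -/
theorem mk_smul_eq_of_mk_eq {C : AddSubgroup M} (hC : ∀ σ : G, ∀ x ∈ C, σ • x ∈ C) (σ : G)
    {x y : M} (h : (x : M ⧸ C) = y) : ((σ • x : M) : M ⧸ C) = ((σ • y : M) : M ⧸ C) := by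
  rw [QuotientAddGroup.eq_iff_sub_mem] at h ⊢
  rw [← smul_sub]
  exact hC σ _ h

/-- **The abstract splitting lemma** (memo B3 / A2; Serre, *Local Fields* VII §§1–2 by hand). See the
module docstring: an extension of the `ω`-line by the trivial line, read modulo a `G`-stable subgroup
`C`, splits as soon as its cocycle restricted to `ker ω` — a homomorphism `ker ω → ℤ/3` — is killed by
the given subgroups (`hI`: they fix `Q`; `hD`: they stabilise a complement) and every such homomorphism
is trivial (`hGK`, the class-number-one input). The conclusion exhibits the stable complement
`ℤ•(Q + aP) + C`. [cite: SerreLocalFields1979, Ch. VII §1–§2] [cite: Washington1997, Thm. 11.1] -/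
theorem exists_stable_complement_mod
    {C : AddSubgroup M} (hC : ∀ σ : G, ∀ x ∈ C, σ • x ∈ C)
    {P Q : M} (ω : G →* ℤˣ) {c : G → ℤ}
    (hP : ∀ σ : G, σ • P - P ∈ C)
    (hQ : ∀ σ : G, σ • Q - (((ω σ : ℤˣ) : ℤ) • Q + c σ • P) ∈ C)
    (hind : ∀ a b : ℤ, a • P + b • Q ∈ C ↔ (3 : ℤ) ∣ a ∧ (3 : ℤ) ∣ b)
    {ιI ιD : Type*} (I : ιI → Subgroup G) (D : ιD → Subgroup G)
    (hI : ∀ j, ∀ σ ∈ I j, σ • Q - Q ∈ C)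
    (hD : ∀ k, ∃ Λ : AddSubgroup M, (∀ σ ∈ D k, ∀ x ∈ Λ, σ • x ∈ Λ) ∧
        (∃ x ∈ Λ, ∃ a : ℤ, x - (Q + a • P) ∈ C) ∧ (∀ x ∈ Λ, ∀ b : ℤ, x - b • P ∈ C → (3 : ℤ) ∣ b))
    (hGK : ∀ η : ω.ker →* Multiplicative (ZMod 3),
        (∀ j, ∀ σ : ω.ker, (σ : G) ∈ I j → η σ = 1) →
        (∀ k, ∀ σ : ω.ker, (σ : G) ∈ D k → η σ = 1) → η = 1) :
    ∃ a : ℤ, ∀ σ : G, σ • (Q + a • P) - ((ω σ : ℤˣ) : ℤ) • (Q + a • P) ∈ C := by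
  -- Notation: `π : M → M ⧸ C`; the hypotheses as identities in `M ⧸ C`.
  have hπP : ∀ σ : G, ((σ • P : M) : M ⧸ C) = (P : M ⧸ C) := fun σ ↦
    (QuotientAddGroup.eq_iff_sub_mem).mpr (hP σ)
  have hπQ : ∀ σ : G, ((σ • Q : M) : M ⧸ C) =
      ((ω σ : ℤˣ) : ℤ) • (Q : M ⧸ C) + c σ • (P : M ⧸ C) := fun σ ↦ by
    have h := (QuotientAddGroup.eq_iff_sub_mem).mpr (hQ σ)
    rw [h]; simp
  have hind' : ∀ a b : ℤ, a • (P : M ⧸ C) + b • (Q : M ⧸ C) = 0 ↔ (3 : ℤ) ∣ a ∧ (3 : ℤ) ∣ b := by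
    intro a b
    rw [← hind, ← QuotientAddGroup.eq_zero_iff]
    simp
  have h3P : (3 : ℤ) • P ∈ C := by
    have h := (hind 3 0).mpr ⟨dvd_rfl, dvd_zero _⟩
    simpa using h
  have hω : ∀ σ : G, ((ω σ : ℤˣ) : ℤ) = 1 ∨ ((ω σ : ℤˣ) : ℤ) = -1 := fun σ ↦ by
    rcases Int.units_eq_one_or (ω σ) with h | h <;> simp [h]
  -- (1) the cocycle identity `c(στ) ≡ ω(τ) c(σ) + c(τ) (mod 3)`
  have hcoc : ∀ σ τ : G, (3 : ℤ) ∣ c (σ * τ) - (((ω τ : ℤˣ) : ℤ) * c σ + c τ) := by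
    intro σ τ
    -- `π((στ)Q)` computed directly and through `σ(τQ)`
    have h1 := hπQ (σ * τ)
    have h2 : (((σ * τ) • Q : M) : M ⧸ C) =
        (((ω σ : ℤˣ) : ℤ) * ((ω τ : ℤˣ) : ℤ)) • (Q : M ⧸ C) +
          (((ω τ : ℤˣ) : ℤ) * c σ + c τ) • (P : M ⧸ C) := by
      have hτQ : ((τ • Q : M) : M ⧸ C) =
          (((((ω τ : ℤˣ) : ℤ) • Q + c τ • P : M)) : M ⧸ C) := by rw [hπQ τ]; simp
      rw [mul_smul, mk_smul_eq_of_mk_eq hC σ hτQ, smul_add, smul_zsmul_comm, smul_zsmul_comm,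
        QuotientAddGroup.mk_add, QuotientAddGroup.mk_zsmul, QuotientAddGroup.mk_zsmul, hπQ σ, hπP σ]
      module
    rw [h1, map_mul, Units.val_mul] at h2
    -- compare coefficients
    have h0 : (0 : ℤ) • (P : M ⧸ C) + (0 : ℤ) • (Q : M ⧸ C) = 0 := by simp
    have hdiff : (c (σ * τ) - (((ω τ : ℤˣ) : ℤ) * c σ + c τ)) • (P : M ⧸ C) + (0 : ℤ) • (Q : M ⧸ C)
        = 0 := by
      have e := sub_eq_zero.mpr h2
      rw [← e]; module
    exact ((hind' _ _).mp hdiff).1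
  -- `c(1) ≡ 0`
  have hc1 : (3 : ℤ) ∣ c 1 := by
    have h := hπQ 1
    rw [one_smul, map_one, Units.val_one, one_smul] at h
    have h' : c 1 • (P : M ⧸ C) = 0 := by
      have := h.symm
      rwa [add_eq_left] at this
    have hdiff : (c 1) • (P : M ⧸ C) + (0 : ℤ) • (Q : M ⧸ C) = 0 := by simpa using h'
    exact ((hind' _ _).mp hdiff).1
  have hdvd_iff : ∀ z : ℤ, ((z : ZMod 3) = 0) ↔ (3 : ℤ) ∣ z := fun z ↦ by
    rw [ZMod.intCast_zmod_eq_zero_iff_dvd, Nat.cast_ofNat]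
  -- (2) the homomorphism `η : ker ω → ℤ/3`
  have hker : ∀ σ : ω.ker, ((ω (σ : G) : ℤˣ) : ℤ) = 1 := fun σ ↦ by
    have h : ω (σ : G) = 1 := σ.2
    simp [h]
  let η : ω.ker →* Multiplicative (ZMod 3) :=
    { toFun := fun σ ↦ Multiplicative.ofAdd ((c (σ : G) : ℤ) : ZMod 3)
      map_one' := by
        change Multiplicative.ofAdd ((c (1 : G) : ℤ) : ZMod 3) = 1
        rw [(hdvd_iff (c 1)).mpr hc1]
        rfl
      map_mul' := by
        intro σ τ
        change Multiplicative.ofAdd ((c ((σ : G) * (τ : G)) : ℤ) : ZMod 3) =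
          Multiplicative.ofAdd ((c (σ : G) : ℤ) : ZMod 3) * Multiplicative.ofAdd ((c (τ : G) : ℤ) : ZMod 3)
        rw [← ofAdd_add]
        congr 1
        have h := hcoc (σ : G) (τ : G)
        rw [hker τ, one_mul] at h
        have h' : ((c (σ : G) + c (τ : G) : ℤ) : ZMod 3) = ((c ((σ : G) * (τ : G)) : ℤ) : ZMod 3) := by
          rw [ZMod.intCast_eq_intCast_iff_dvd_sub, Nat.cast_ofNat]
          exact h
        rw [← h', Int.cast_add] }
  have hηapply : ∀ σ : ω.ker, η σ = Multiplicative.ofAdd ((c (σ : G) : ℤ) : ZMod 3) := fun _ ↦ rfl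
  have hη1 : ∀ σ : ω.ker, η σ = 1 ↔ (3 : ℤ) ∣ c (σ : G) := by
    intro σ
    rw [hηapply, ← hdvd_iff]
    exact ⟨fun h ↦ by simpa using congrArg Multiplicative.toAdd h, fun h ↦ by rw [h]; rfl⟩
  -- (3) `η` is killed by the `I j`
  have hηI : ∀ j, ∀ σ : ω.ker, (σ : G) ∈ I j → η σ = 1 := by
    intro j σ hσ
    rw [hη1]
    have h := hπQ (σ : G)
    rw [hker σ, one_smul, (QuotientAddGroup.eq_iff_sub_mem).mpr (hI j _ hσ)] at h
    have hdiff : (c (σ : G)) • (P : M ⧸ C) + (0 : ℤ) • (Q : M ⧸ C) = 0 := by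
      have e := sub_eq_zero.mpr h
      rw [← neg_eq_zero, ← e]; module
    exact ((hind' _ _).mp hdiff).1
  -- (4) `η` is killed by the `D k`
  have hηD : ∀ k, ∀ σ : ω.ker, (σ : G) ∈ D k → η σ = 1 := by
    intro k σ hσ
    rw [hη1]
    obtain ⟨Λ, hΛst, ⟨x, hxΛ, a, hxa⟩, hΛP⟩ := hD k
    -- `σ x - x ≡ c(σ) P (mod C)` lies in `Λ`
    have hπx : (x : M ⧸ C) = ((Q + a • P : M) : M ⧸ C) := (QuotientAddGroup.eq_iff_sub_mem).mpr hxa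
    have hσx : ((σ : G) • x : M) - x - c (σ : G) • P ∈ C := by
      rw [← QuotientAddGroup.eq_zero_iff, QuotientAddGroup.mk_sub, QuotientAddGroup.mk_sub,
        mk_smul_eq_of_mk_eq hC (σ : G) hπx, hπx, smul_add, smul_zsmul_comm, QuotientAddGroup.mk_add,
        QuotientAddGroup.mk_add, QuotientAddGroup.mk_zsmul, QuotientAddGroup.mk_zsmul,
        QuotientAddGroup.mk_zsmul, hπQ, hπP, hker σ]
      module
    have hmem : (σ : G) • x - x ∈ Λ := Λ.sub_mem (hΛst _ hσ x hxΛ) hxΛ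
    exact hΛP _ hmem (c (σ : G)) hσx
  -- (5) the arithmetic input: `η = 1`, i.e. `3 ∣ c σ` on `ker ω`
  have hη : η = 1 := hGK η hηI hηD
  have hcK : ∀ σ : G, ω σ = 1 → (3 : ℤ) ∣ c σ := by
    intro σ hσ
    have h := (hη1 ⟨σ, hσ⟩).mp (by rw [hη]; rfl)
    exact h
  -- (6) the coboundary: `a := c τ` for some `τ ∉ ker ω` (or `0` if `ω = 1`)
  have hcob : ∃ a : ℤ, ∀ σ : G, (3 : ℤ) ∣ c σ - (((ω σ : ℤˣ) : ℤ) - 1) * a := by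
    by_cases hex : ∃ τ : G, ω τ ≠ 1
    · obtain ⟨τ, hτ⟩ := hex
      have hτ' : ((ω τ : ℤˣ) : ℤ) = -1 := by
        rcases Int.units_eq_one_or (ω τ) with h | h
        · exact absurd h hτ
        · simp [h]
      refine ⟨c τ, fun σ ↦ ?_⟩
      by_cases hσ : ω σ = 1
      · have : ((ω σ : ℤˣ) : ℤ) = 1 := by simp [hσ]
        rw [this, sub_self, zero_mul, sub_zero]
        exact hcK σ hσ
      · have hσ' : ((ω σ : ℤˣ) : ℤ) = -1 := by
          rcases Int.units_eq_one_or (ω σ) with h | h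
          · exact absurd h hσ
          · simp [h]
        -- `σ = τ · (τ⁻¹σ)` with `τ⁻¹σ ∈ ker ω`: `c σ ≡ ω(τ⁻¹σ) c τ + c(τ⁻¹σ) ≡ c τ`
        have hk : ω (τ⁻¹ * σ) = 1 := by
          rw [map_mul, map_inv]
          rcases Int.units_eq_one_or (ω τ) with h | h
          · exact absurd h hτ
          · rcases Int.units_eq_one_or (ω σ) with h' | h'
            · exact absurd h' hσ
            · rw [h, h']; decide
        have h1 := hcoc τ (τ⁻¹ * σ)
        rw [mul_inv_cancel_left, show ((ω (τ⁻¹ * σ) : ℤˣ) : ℤ) = 1 by simp [hk], one_mul] at h1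
        have h2 := hcK _ hk
        rw [hσ']
        have e : c σ - (-1 - 1) * c τ = (c σ - (c τ + c (τ⁻¹ * σ))) + c (τ⁻¹ * σ) + 3 * c τ := by ring
        rw [e]
        exact dvd_add (dvd_add h1 h2) (dvd_mul_right 3 _)
    · push Not at hex
      refine ⟨0, fun σ ↦ ?_⟩
      rw [mul_zero, sub_zero]
      exact hcK σ (hex σ)
  -- (7) conclusion
  obtain ⟨a, ha⟩ := hcob
  refine ⟨a, fun σ ↦ ?_⟩
  obtain ⟨m, hm⟩ := ha σ
  rw [← QuotientAddGroup.eq_zero_iff, smul_add, smul_zsmul_comm, QuotientAddGroup.mk_sub,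
    QuotientAddGroup.mk_add, QuotientAddGroup.mk_zsmul, QuotientAddGroup.mk_zsmul, QuotientAddGroup.mk_add,
    QuotientAddGroup.mk_zsmul, hπQ σ, hπP σ]
  have hmP : ((3 * m) • P : M) ∈ C := by rw [mul_comm, mul_smul]; exact C.zsmul_mem h3P m
  have hπmP : ((3 * m) • (P : M ⧸ C)) = 0 := by
    rw [← QuotientAddGroup.eq_zero_iff] at hmP
    simpa using hmP
  have e : ((ω σ : ℤˣ) : ℤ) • (Q : M ⧸ C) + c σ • (P : M ⧸ C) + a • (P : M ⧸ C) -
      ((ω σ : ℤˣ) : ℤ) • ((Q : M ⧸ C) + a • (P : M ⧸ C)) =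
      (c σ - (((ω σ : ℤˣ) : ℤ) - 1) * a) • (P : M ⧸ C) := by module
  rw [e, hm, hπmP]

end Summit.BirchSwinnertonDyer.BirchSwinnertonDyer.Theorems.FullDescentSplitting
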